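import Literature.NumberTheory.Automorphic.Liu2021.Def411WeilCarriersFrameTransport
import Literature.NumberTheory.GelbartRogawski1991.DoubledKroneckerConjugationFrame
import Literature.NumberTheory.GelbartRogawski1991.DoubledWeilRepresentationIsometryTransportModel
import Literature.NumberTheory.GelbartRogawski1991.DoubledKroneckerConjugationOmega
import HarnessLib

/-!
# Liu 2021 Def. 4.11 — frame independence of the χ-attached finite Weil representation: the proof

`chiSplittingFrameTransport_holds : chiSplittingFrameTransport` (the statement of `Def411WeilCarriersFrameTransport`), by
`chiSplittingFrameTransport_of_model_pieces` applied to the model construction of [GelbartRogawski1991, §3.1] at the Kronecker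
index: the rational Gram transporter `C₀` (`exists_gramTransporter`), Weil's Θ-fixing lift `r := r_{L⁺}(Ad(B⁻¹ ⊗ 1))` (`rKron`,
[Weil1964, Chap. III n° 38–40]) with its decomposable operator (`exists_omega_tmul_ratPointsThetaLiftCont_realDiagonal`), the
conjugation `θ := Ad(B⁻¹ ⊗ 1)` on `U(diag dV′ ⊗ J_W)(𝔸)` with its point bookkeeping (`aOfB`, `adelicPairIsometryConjLeft_aOfB_adelicInl`,
`…_adelicInr`), and the Kronecker operator identity `hω` — `hω_of_T4` at the doubled isometry transport
`conjSplitting_doubledWeilRep_comp_thetaD` ([Kudla1994, §2]; [MoeglinVignerasWaldspurger1987, Chap. 2 II.1]).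
Nothing else is in this file.  References: [Liu2021] Def. 4.11, App. D §D.1 Step 2; [GelbartRogawski1991] §3.1 Prop. 3.1.1, Remark
p. 457; [Weil1964] Chap. III n° 38–41; [Kudla1994] §2, Thm. 3.1; [MoeglinVignerasWaldspurger1987] Chap. 2 II.1.
-/

set_option autoImplicit false

noncomputable section

open scoped Matrix Kronecker TensorProduct SchwartzMap Classical
open NumberField NumberField.mixedEmbedding IsDedekindDomain
open Literature.NumberTheory.Automorphic Literature.NumberTheory.Automorphic.UnitaryGroup
open Literature.NumberTheory.Weil1964 Literature.RepresentationTheory.HeisenbergGroup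
open Literature.RepresentationTheory.HeisenbergGroup.SymplecticMatrix (transportSp mapHom)
open Literature.NumberTheory.GaloisRepresentations

namespace Literature.NumberTheory.Automorphic.Liu2021.Def411WeilCarriersDoubling

open Literature.NumberTheory.GelbartRogawski1991 Literature.NumberTheory.GelbartRogawski1991.UnitaryDualPair
open Literature.NumberTheory.GelbartRogawski1991.UnitaryDualPair.WeilCoinv
open Literature.NumberTheory.GelbartRogawski1991.UnitaryDualPair.LocalSplitting
open Literature.NumberTheory.GelbartRogawski1991.GRConstruction
open Literature.RepresentationTheory.HarrisKudlaSweet1996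

/-- **FRAME INDEPENDENCE OF THE χ-ATTACHED FINITE WEIL REPRESENTATION.**  For real diagonal frames `dV, dV′` of a hermitian space
related by a rational isometry `B`, a unitary splitting character `χ` and any hermitian line `⟨T_W⟩`, the finite Weil representations
at the χ-attached splittings `s_χ[dV]`, `s_χ[dV′]` of `U(diag dV ⊗ J_W)(𝔸) ⊇ U(V)(𝔸_f) × U(W)(𝔸_f)` are conjugate by ONE linear
automorphism of `𝒮((𝔸_{L⁺,f})^N)`, over `finAdelicCongr B` on `U(V)` and identically on `U(W)`.  Assembly of the model pieces: the Gram
transporter `C₀`, Weil's Θ-fixing lift `r := r_{L⁺}(Ad(B⁻¹ ⊗ 1))` at the Kronecker index (`rKron`) with its decomposable operator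
([Weil1964, n° 38–40]), the conjugation `θ = Ad(B⁻¹ ⊗ 1)` on `U(diag dV′ ⊗ J_W)(𝔸)` with its point bookkeeping (`aOfB`), and the
Kronecker operator identity `hω` (`hω_of_T4` at the doubled isometry transport `conjSplitting_doubledWeilRep_comp_thetaD`).
[cite: Liu2021, Def. 4.11 (l. 2092–2096); App. D §D.1 Step 2 (l. 5219)] [cite: MoeglinVignerasWaldspurger1987, Chap. 2 II.1]
[cite: Kudla1994, §2 (doubled space, Siegel parabolic), Thm. 3.1] [cite: GelbartRogawski1991, §3.1 Prop. 3.1.1 p. 455, Remark p. 457]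
[cite: Weil1964, Chap. III n° 38–41 pp. 188–193] -/
theorem chiSplittingFrameTransport_holds : chiSplittingFrameTransport :=
  chiSplittingFrameTransport_of_model_pieces
    fun L _ _ _ N n e dV hdV hdV0 dV' hdV' hdV'0 B hB χ hχu hχs dW hdW hdW0 => by
      have hCex := exists_gramTransporter L dV hdV hdV0 dV' hdV' hdV'0 dW hdW hdW0
      obtain ⟨C₀, C, hCC₀, hC⟩ := hCex
      -- clause `hq` for `r := rKron` (whose definition IS `ratPointsThetaLiftCont … (isUnit_det_kron …) ⟨h₀, h₀ ∈ range⟩`, matched by delta)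
      have hqex := exists_omega_tmul_ratPointsThetaLiftCont_realDiagonal L dV hdV hdV0 dW hdW hdW0
        (isUnit_det_kron L dV hdV hdV0 dW hdW hdW0)
        ⟨adelicSeesawConjLeft (Fp L) L (IsCMField.complexConj L) N 1 (complexConj_imagUnit L) (imagUnit_ne_zero L)
            (imagUnit_mul_self L) (realDiagonal_isSymm L dV hdV) (realDiagonal_isSymm L dV' hdV') (realDiagonal_isSymm L dW hdW)
            (realDiagonal_map L dV hdV).symm (realDiagonal_map L dV' hdV').symm (realDiagonal_map L dW hdW).symm (aOfB L B)
            (aOfB_isometry L dV dV' B hB) C hC,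
          adelicSeesawConjLeft_mem_range (Fp L) L (IsCMField.complexConj L) N 1 (complexConj_imagUnit L) (imagUnit_ne_zero L)
            (imagUnit_mul_self L) (realDiagonal_isSymm L dV hdV) (realDiagonal_isSymm L dV' hdV') (realDiagonal_isSymm L dW hdW)
            (isUnit_det_realDiagonal L dV hdV hdV0) (isUnit_det_realDiagonal L dW hdW hdW0)
            (isUnit_det_kron L dV hdV hdV0 dW hdW hdW0) (realDiagonal_map L dV hdV).symm (realDiagonal_map L dV' hdV').symm
            (realDiagonal_map L dW hdW).symm (coe_aOfB L B) (aOfB_isometry L dV dV' B hB) hCC₀ hC⟩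
      obtain ⟨A, Qf, hq⟩ := hqex
      exact ⟨rKron L dV hdV hdV0 dV' hdV' dW hdW hdW0 (coe_aOfB L B) (aOfB_isometry L dV dV' B hB) hCC₀ hC, A, Qf,
        adelicPairIsometryConjLeft (Fp L) L (IsCMField.complexConj L) N 1 (aOfB L B) (aOfB_isometry L dV dV' B hB), hq,
        fun k' => adelicPairIsometryConjLeft_aOfB_adelicInl L dV dV' B hB (Matrix.diagonal dW) k',
        fun u => adelicPairIsometryConjLeft_aOfB_adelicInr L dV dV' B hB (Matrix.diagonal dW) u,
        hω_of_T4 L e dV hdV hdV0 dV' hdV' hdV'0 dW hdW hdW0 B hB hCC₀ hC χ hχu hχs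
          (conjSplitting_doubledWeilRep_comp_thetaD L e dV hdV hdV0 dV' hdV' hdV'0 dW hdW hdW0 hCC₀ hC B hB χ hχu hχs)⟩

end Literature.NumberTheory.Automorphic.Liu2021.Def411WeilCarriersDoubling

end
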